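import Literature.LinearAlgebra.SemisimpleOperatorInvariantSums   -- ★ `ker_inf_range_eq_bot_of_isSemisimple`
import Mathlib.LinearAlgebra.Semisimple
import Mathlib.LinearAlgebra.Matrix.Charpoly.LinearMap
import Mathlib.FieldTheory.Separable
import Mathlib.Algebra.Algebra.Bilinear
import HarnessLib

/-!
# For a matrix with separable characteristic polynomial, `M_n(K) = [A, M_n(K)] ⊕ C(A)`:
# the commutator map `ad A : X ↦ AX − XA` is semisimple, so its kernel (the commutant) and its range are complementary

Topic `LinearAlgebra/Matrix`; namespace `Literature.LinearAlgebra.Matrix`. KERNEL mathematics only: theorems, no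
definition, no named fact, no instance, no notation, no `sorry`.  Generic linear algebra over a PERFECT field `K`
(e.g. characteristic zero), written for the cell `pub/hodgecm-mathlib` (LEAD F0P3a-plan (g8) WORD T7-65, brick
«N6ns-chart», FILE A): the differential at `(1, γ)` of the orbit map `(g, t) ↦ g t g⁻¹ : GL_n × T → GL_n` (`T` the
centraliser torus of a regular semisimple `γ`) is `(X, Y) ↦ [X, γ] + Y`, and its SURJECTIVITY — the submersivity
behind the regular orbit chart (FILE B `NumberTheory/Automorphic/RegularOrbitChartNonarch`, Harish-Chandra's
principle) — is exactly `range (ad γ) + ker (ad γ) = M_n(K)`.  Mechanism (Borel, *Linear Algebraic Groups* I.4):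
`ad A = L_A − R_A` is the difference of two COMMUTING endomorphisms of `M_n(K)`, each annihilated by the separable,
hence square-free, polynomial `χ_A` (Cayley–Hamilton), hence semisimple (Mathlib
`Module.End.isSemisimple_of_squarefree_aeval_eq_zero`); over a perfect field the difference is again semisimple
(Mathlib `Module.End.IsSemisimple.sub_of_commute`); and a semisimple endomorphism of a finite-dimensional space has
`ker f ⊕ range f = V`.

* §1 `Module.End.IsSemisimple.isCompl_ker_range` — **`V = ker f ⊕ range f`** for a semisimple endomorphism `f` of a
  finite-dimensional `K`-vector space (an `f`-invariant complement `q` of `ker f` is mapped injectively, hence onto,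
  itself, so `q = range f`); `Module.End.IsSemisimple.ker_sup_range_eq_top` (the `⊓ = ⊥` half is ★
  `Literature.LinearAlgebra.ker_inf_range_eq_bot_of_isSemisimple`, imported).
* §2 `aeval_mulLeft_apply`, `aeval_mulRight_apply` (`p(L_A) X = p(A) X`, `p(R_A) X = X p(A)`);
  `isSemisimple_mulLeft_of_separable_charpoly`, `isSemisimple_mulRight_of_separable_charpoly`,
  **`isSemisimple_mulLeft_sub_mulRight_of_separable_charpoly`** (`ad A = L_A − R_A` semisimple, `[PerfectField K]`).
* §3 **`isCompl_ker_range_ad_of_separable_charpoly`** and the two readings consumed by the orbit chart: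
  **`exists_commute_add_commutator_eq_of_separable_charpoly`** (`∀ Z, ∃ X Y, Y A = A Y ∧ Z = (A X − X A) + Y`) and
  **`commutator_eq_zero_of_commutator_commutator_eq_zero`** (`[A, [A, X]] = 0 → [A, X] = 0`, i.e.
  `ker (ad A)² = ker (ad A)`).

## References

* [Borel1991] A. Borel, *Linear Algebraic Groups*, 2nd ed., GTM 126 (1991), I.4 (4.2: semisimple endomorphisms;
  4.4: Jordan decomposition, `Ad s` is semisimple for semisimple `s`) — used in the elementary form «commuting
  semisimple operators over a perfect field have a semisimple difference».
* [HornJohnson2013] R. A. Horn, C. R. Johnson, *Matrix Analysis*, 2nd ed. (2013), §4.4 (the operator `X ↦ AX − XB`).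
-/

set_option autoImplicit false

open Polynomial Module

namespace Literature.LinearAlgebra.Matrix

/-! ### 1. A semisimple endomorphism has complementary kernel and range -/

section Semisimple

variable {K V : Type*} [Field K] [AddCommGroup V] [Module K V] [FiniteDimensional K V]

/-- **`V = ker f ⊕ range f` for a semisimple endomorphism** of a finite-dimensional vector space: the kernel is
`f`-invariant, so it has an `f`-invariant complement `q` (Mathlib `Module.End.isSemisimple_iff`); `f` is injective on
`q`, hence maps `q` ONTO `q` (finite dimension), so `q ≤ range f`, and counting dimensions `q = range f`.
[cite: Borel1991, I.4 (4.2, 4.4)] -/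
theorem _root_.Module.End.IsSemisimple.isCompl_ker_range {f : Module.End K V} (hf : f.IsSemisimple) :
    IsCompl (LinearMap.ker f) (LinearMap.range f) := by
  have hker : LinearMap.ker f ∈ Module.End.invtSubmodule f := by
    rw [Module.End.mem_invtSubmodule]
    intro x hx
    rw [LinearMap.mem_ker] at hx
    rw [Submodule.mem_comap, LinearMap.mem_ker, hx, map_zero]
  obtain ⟨q, hq, hc⟩ := Module.End.isSemisimple_iff.mp hf (LinearMap.ker f) hker
  rw [Module.End.mem_invtSubmodule] at hq
  -- `f` restricted to `q` is injective, hence surjective onto `q`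
  have hinj : Function.Injective (f.restrict hq) := by
    intro x y hxy
    apply Subtype.ext
    have h0 : f ((x : V) - y) = 0 := by
      rw [map_sub, sub_eq_zero]; exact congrArg Subtype.val hxy
    have hmem : ((x : V) - y) ∈ LinearMap.ker f ⊓ q := ⟨h0, q.sub_mem x.2 y.2⟩
    rw [hc.inf_eq_bot, Submodule.mem_bot] at hmem
    exact sub_eq_zero.mp hmem
  have hsurj : Function.Surjective (f.restrict hq) := LinearMap.injective_iff_surjective.mp hinj
  have hqr : q ≤ LinearMap.range f := fun y hy => by
    obtain ⟨x, hx⟩ := hsurj ⟨y, hy⟩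
    exact ⟨(x : V), congrArg Subtype.val hx⟩
  -- dimensions: `dim q = dim V − dim ker = dim range`
  have hdim : Module.finrank K q = Module.finrank K (LinearMap.range f) := by
    have h1 := Submodule.finrank_add_eq_of_isCompl hc
    have h2 := LinearMap.finrank_range_add_finrank_ker f
    omega
  rw [← Submodule.eq_of_le_of_finrank_eq hqr hdim]
  exact hc

/-- `ker f ⊔ range f = ⊤` for a semisimple endomorphism (finite dimension). [cite: Borel1991, I.4 (4.2, 4.4)] -/
theorem _root_.Module.End.IsSemisimple.ker_sup_range_eq_top {f : Module.End K V} (hf : f.IsSemisimple) :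
    LinearMap.ker f ⊔ LinearMap.range f = ⊤ :=
  hf.isCompl_ker_range.sup_eq_top

end Semisimple

/-! ### 2. `L_A`, `R_A` and `ad A = L_A − R_A` are semisimple when `χ_A` is separable -/

section Ad

variable {K : Type*} [Field K] {n : Type*} [Fintype n] [DecidableEq n]

/-- `p(L_A) X = p(A) · X`: evaluating a polynomial at left multiplication by `A`. [cite: HornJohnson2013, §4.4] -/
theorem aeval_mulLeft_apply (A : Matrix n n K) (p : K[X]) (X : Matrix n n K) :
    aeval (LinearMap.mulLeft K A) p X = aeval A p * X := by
  induction p using Polynomial.induction_on' with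
  | add p q hp hq => rw [map_add, map_add, LinearMap.add_apply, hp, hq, add_mul]
  | monomial k c =>
    rw [Polynomial.aeval_monomial, Polynomial.aeval_monomial, LinearMap.pow_mulLeft, Module.End.mul_apply,
      LinearMap.mulLeft_apply, Module.algebraMap_end_apply, Algebra.algebraMap_eq_smul_one, smul_mul_assoc, one_mul,
      smul_mul_assoc]

/-- `p(R_A) X = X · p(A)`: evaluating a polynomial at right multiplication by `A` (on the commutative subalgebra `K[A]`
right multiplication is multiplicative, `LinearMap.pow_mulRight`). [cite: HornJohnson2013, §4.4] -/
theorem aeval_mulRight_apply (A : Matrix n n K) (p : K[X]) (X : Matrix n n K) :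
    aeval (LinearMap.mulRight K A) p X = X * aeval A p := by
  induction p using Polynomial.induction_on' with
  | add p q hp hq => rw [map_add, map_add, LinearMap.add_apply, hp, hq, mul_add]
  | monomial k c =>
    rw [Polynomial.aeval_monomial, Polynomial.aeval_monomial, LinearMap.pow_mulRight, Module.End.mul_apply,
      LinearMap.mulRight_apply, Module.algebraMap_end_apply, Algebra.algebraMap_eq_smul_one, smul_mul_assoc, one_mul,
      mul_smul_comm]

/-- **`L_A` is semisimple when `χ_A` is separable**: `χ_A(L_A) = L_{χ_A(A)} = 0` (Cayley–Hamilton) with `χ_A`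
square-free (Mathlib `Module.End.isSemisimple_of_squarefree_aeval_eq_zero`). [cite: Borel1991, I.4 (4.2, 4.4)] -/
theorem isSemisimple_mulLeft_of_separable_charpoly (A : Matrix n n K) (hA : A.charpoly.Separable) :
    Module.End.IsSemisimple (LinearMap.mulLeft K A : Module.End K (Matrix n n K)) := by
  refine Module.End.isSemisimple_of_squarefree_aeval_eq_zero hA.squarefree (LinearMap.ext fun X => ?_)
  rw [aeval_mulLeft_apply, Matrix.aeval_self_charpoly, zero_mul, LinearMap.zero_apply]

/-- **`R_A` is semisimple when `χ_A` is separable** (same argument on the right). [cite: Borel1991, I.4 (4.2, 4.4)] -/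
theorem isSemisimple_mulRight_of_separable_charpoly (A : Matrix n n K) (hA : A.charpoly.Separable) :
    Module.End.IsSemisimple (LinearMap.mulRight K A : Module.End K (Matrix n n K)) := by
  refine Module.End.isSemisimple_of_squarefree_aeval_eq_zero hA.squarefree (LinearMap.ext fun X => ?_)
  rw [aeval_mulRight_apply, Matrix.aeval_self_charpoly, mul_zero, LinearMap.zero_apply]

/-- **`ad A = L_A − R_A` is semisimple when `χ_A` is separable** (`K` perfect): `L_A` and `R_A` commute
(`(AX)A = A(XA)`) and are semisimple, and over a perfect field commuting semisimple endomorphisms have a semisimple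
difference (Mathlib `Module.End.IsSemisimple.sub_of_commute`) — the elementary form of «`Ad s` is semisimple for
semisimple `s`». [cite: Borel1991, I.4 (4.2, 4.4)] -/
theorem isSemisimple_mulLeft_sub_mulRight_of_separable_charpoly [PerfectField K] (A : Matrix n n K)
    (hA : A.charpoly.Separable) :
    Module.End.IsSemisimple (LinearMap.mulLeft K A - LinearMap.mulRight K A : Module.End K (Matrix n n K)) :=
  Module.End.IsSemisimple.sub_of_commute (LinearMap.commute_mulLeft_right A A)
    (isSemisimple_mulLeft_of_separable_charpoly A hA) (isSemisimple_mulRight_of_separable_charpoly A hA)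

/-! ### 3. `M_n(K) = range (ad A) ⊕ C(A)` and its two readings -/

/-- **`M_n(K) = [A, M_n(K)] ⊕ C(A)`**: for `A` with separable characteristic polynomial over a perfect field, the kernel
of `ad A = L_A − R_A` (the commutant `C(A)`) and its range (the commutators `AX − XA`) are complementary subspaces.
[cite: Borel1991, I.4 (4.2, 4.4)] -/
theorem isCompl_ker_range_mulLeft_sub_mulRight_of_separable_charpoly [PerfectField K] (A : Matrix n n K)
    (hA : A.charpoly.Separable) :
    IsCompl (LinearMap.ker (LinearMap.mulLeft K A - LinearMap.mulRight K A : Module.End K (Matrix n n K)))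
      (LinearMap.range (LinearMap.mulLeft K A - LinearMap.mulRight K A : Module.End K (Matrix n n K))) :=
  (isSemisimple_mulLeft_sub_mulRight_of_separable_charpoly A hA).isCompl_ker_range

/-- **Every matrix is a commutator with `A` plus an element of the commutant of `A`** (`χ_A` separable, `K` perfect):
`∀ Z, ∃ X Y, Y A = A Y ∧ Z = (A X − X A) + Y` — the surjectivity of `(X, Y) ↦ [A, X] + Y : M_n(K) × C(A) → M_n(K)`,
i.e. of the differential of the orbit map `(g, t) ↦ g t g⁻¹` at `(1, A)` (the submersivity behind the regular orbit
chart). [cite: Borel1991, I.4 (4.2, 4.4)] [cite: HornJohnson2013, §4.4] -/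
theorem exists_commute_add_commutator_eq_of_separable_charpoly [PerfectField K] (A : Matrix n n K)
    (hA : A.charpoly.Separable) (Z : Matrix n n K) :
    ∃ X Y : Matrix n n K, Y * A = A * Y ∧ Z = (A * X - X * A) + Y := by
  have hZ : Z ∈ LinearMap.ker (LinearMap.mulLeft K A - LinearMap.mulRight K A : Module.End K (Matrix n n K)) ⊔
      LinearMap.range (LinearMap.mulLeft K A - LinearMap.mulRight K A : Module.End K (Matrix n n K)) := by
    rw [(isSemisimple_mulLeft_sub_mulRight_of_separable_charpoly A hA).ker_sup_range_eq_top]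
    exact Submodule.mem_top
  obtain ⟨Y, hY, W, hW, hYW⟩ := Submodule.mem_sup.mp hZ
  obtain ⟨X, rfl⟩ := LinearMap.mem_range.mp hW
  rw [LinearMap.mem_ker, LinearMap.sub_apply, LinearMap.mulLeft_apply, LinearMap.mulRight_apply, sub_eq_zero] at hY
  refine ⟨X, Y, hY.symm, ?_⟩
  rw [← hYW, add_comm, LinearMap.sub_apply, LinearMap.mulLeft_apply, LinearMap.mulRight_apply]

/-- **`[A, [A, X]] = 0 ⇒ [A, X] = 0`** (`χ_A` separable, `K` perfect): `ker (ad A)² = ker (ad A)`, since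
`ker (ad A) ∩ range (ad A) = 0` (★ `ker_inf_range_eq_bot_of_isSemisimple`). [cite: Borel1991, I.4 (4.2, 4.4)] [cite: HornJohnson2013, §4.4] -/
theorem commutator_eq_zero_of_commutator_commutator_eq_zero [PerfectField K] (A : Matrix n n K)
    (hA : A.charpoly.Separable) (X : Matrix n n K) (h : A * (A * X - X * A) - (A * X - X * A) * A = 0) :
    A * X - X * A = 0 := by
  have h1 : (A * X - X * A) ∈
      LinearMap.ker (LinearMap.mulLeft K A - LinearMap.mulRight K A : Module.End K (Matrix n n K)) := by
    rw [LinearMap.mem_ker, LinearMap.sub_apply, LinearMap.mulLeft_apply, LinearMap.mulRight_apply]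
    exact h
  have h2 : (A * X - X * A) ∈
      LinearMap.range (LinearMap.mulLeft K A - LinearMap.mulRight K A : Module.End K (Matrix n n K)) :=
    ⟨X, by rw [LinearMap.sub_apply, LinearMap.mulLeft_apply, LinearMap.mulRight_apply]⟩
  have hmem := Submodule.mem_inf.mpr ⟨h1, h2⟩
  rw [ker_inf_range_eq_bot_of_isSemisimple (isSemisimple_mulLeft_sub_mulRight_of_separable_charpoly A hA),
    Submodule.mem_bot] at hmem
  exact hmem

end Ad

end Literature.LinearAlgebra.Matrix
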